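import Literature.NumberTheory.Sieve.CFSemigroupRenewalTheorem
import Literature.NumberTheory.LFunctions.EffectivePerronOrderTwo
import Mathlib.Analysis.Complex.RemovableSingularity
import HarnessLib

/-!
# Power saving for the renewal count of `Γ_A` from a finite-order resolvent bound

[MageeOhWinter2019, §3.4 with Thm. 4] derive the error term of the counting theorems from spectral bounds for the
transfer operators: for `|Re s − δ| < ε`, `1 − L_s` is invertible off `s = δ` and the resolvent is of finite order
in `|Im s|` (Dolgopyat–Naud bounds [Thm. 4(2)], expansion for the congruence part [Thm. 4(1)]); a Laplace inversion
with contour shift then gives a power saving [Lemma 15, Lemma 16, Prop. 17]. This file PROVES that implication for the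
weighted renewal count of the boundary coding of `Γ_A` at level `q = 1`,

  `N(X, x; G) = Σ_{w ∈ A^*, denom(M_w, x) ≤ X} G(M_w x)`   (`cfFullCountW A G X x`, `G ∈ CfLip` real, `≥ 0`),

whose generalized Dirichlet series over the countable family of words `w` (lengths `ℓ_w = denom(M_w,x)²`, weights
`a_w = G(M_w x)`) is EXACTLY the resolvent matrix coefficient
`D(s) = Σ_n (L_sⁿ G)(x) = F_{G,x}(s) = ((1 − L_s)^{-1} G)(x)` for `Re s > δ_A` (`dirSeries_cfWord_eq`; tree:
`cfResFun_eq_tsum`, `cfLOp_pow_apply_eq_sum`). By the resolvent pole theorem (`cfResolvent_pole'`: near `δ_A`,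
`(1 − L_s)^{-1} = W_reg(s) + (s − δ_A)^{-1} κ_A^{-1} Π`) the function `H_{G,x}(s) = F_{G,x}(s) − r/(s − δ_A)`,
`r = ν(G) h(x)/κ_A = δ_A c_G(x)` (`cfRenewalRes`), has a removable singularity at `δ_A`.

**Theorem** (`cfFullCountW_powerSaving_of_resolventBound`). Assume
* (units) `1 − L_s` is invertible for `σ₀ < Re s`, `s ≠ δ_A` (`0 ≤ σ₀ < σ₁ < δ_A`);
* (finite order) `‖F_{G,x}(u + it) − r/(u + it − δ_A)‖ ≤ M (1 + |t|)^κ` for `σ₁ ≤ u ≤ δ_A + 1`, `u + it ≠ δ_A`,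
  with `κ < 2`.
Then for `X ≥ √2`:
`|N(X, x; G) − r X^{2δ_A}/δ_A| ≤ (r(2^{δ_A+1} + 1/δ_A) + M·(32/π)·2^{2+σ₁}·S(σ₁,κ)) · X^{2δ_A − 2(δ_A−σ₁)/3}`.
(The main term `r X^{2δ_A}/δ_A = c_G(x) X^{2δ_A}` is the one of the renewal theorem `cfFullCountW_asymp`.) The two
hypotheses are exactly what [MageeOhWinter2019, Thm. 4(2)] (Naud's Dolgopyat estimate, `q = 1`) provides; they are NOT
proved here. The engine is `PerronTwo.abs_countFn_sub_main_le` (`LFunctions/EffectivePerronOrderTwo.lean`).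

## References
* [MageeOhWinter2019] M. Magee, H. Oh, D. Winter, J. reine angew. Math. 753 (2019), §3.1 (3.5)–(3.7), §3.4
  (Lemma 15, Lemma 16, Prop. 17), Thm. 4.
-/

noncomputable section

open Complex Filter Set Metric Real
open scoped Topology

namespace Literature.NumberTheory.Sieve

open Literature.NumberTheory.LFunctions

variable {A : Finset ℕ}

/-! ### The family of words: lengths `denom(M_w, x)²` and weights `G(M_w x)` -/

/-- The words `w ∈ A^* = ⋃_n Aⁿ`. [cite: MageeOhWinter2019, §3.1] -/
abbrev cfWords (A : Finset ℕ) : Type := Σ n : ℕ, (Fin n → A)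

variable (A) in
/-- The length `ℓ_w(x) = denom(M_w, x)²` of a word. [cite: MageeOhWinter2019, §3.1 eq. (3.7)] -/
def cfWordLen (x : ℝ) (w : cfWords A) : ℝ := (cfDenom (cfMat fun i => (w.2 i : ℕ)) x) ^ 2

variable (A) in
/-- The weight `a_w(x) = Re G(M_w x)` of a word. [cite: MageeOhWinter2019, §3.1 eq. (3.1)] -/
def cfWordWt (G : CfLip) (x : ℝ) (w : cfWords A) : ℝ := (G.extend (cfMoeb (cfMat fun i => (w.2 i : ℕ)) x)).re

/-- `denom(M_w, x) ≥ 1` for `x ∈ [0,1]`. [folklore] -/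
theorem one_le_cfDenom_cfMat_digit (hA : ∀ a ∈ A, 1 ≤ a) {n : ℕ} (w : Fin n → A) {x : ℝ} (hx : x ∈ Icc (0 : ℝ) 1) :
    1 ≤ cfDenom (cfMat fun i => (w i : ℕ)) x :=
  (one_le_cfQ_cast hA w).trans (cfDenom_cfMat_mem (one_le_coe_digit hA w) hx).1

/-- `ℓ_w ≥ 1`. [folklore] -/
theorem one_le_cfWordLen (hA : ∀ a ∈ A, 1 ≤ a) {x : ℝ} (hx : x ∈ Icc (0 : ℝ) 1) (w : cfWords A) :
    1 ≤ cfWordLen A x w := by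
  have h := one_le_cfDenom_cfMat_digit hA w.2 hx
  unfold cfWordLen
  nlinarith

/-- `a_w ≥ 0` for `G ≥ 0`. [folklore] -/
theorem cfWordWt_nonneg {G : CfLip} (hG0 : ∀ y : Icc (0 : ℝ) 1, 0 ≤ (G y).re) (x : ℝ) (w : cfWords A) :
    0 ≤ cfWordWt A G x w :=
  hG0 _

/-- `G(M_w x)` is real for `G` real: `G.extend y = Re G.extend y`. [folklore] -/
theorem cfWordWt_coe {G : CfLip} (hGre : ∀ y : Icc (0 : ℝ) 1, (((G y).re : ℝ) : ℂ) = G y) (x : ℝ) (w : cfWords A) :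
    ((cfWordWt A G x w : ℝ) : ℂ) = G.extend (cfMoeb (cfMat fun i => (w.2 i : ℕ)) x) :=
  hGre _

/-- **The complex weight is a complex power of the length:** `denom(M,x)^{-2s} = (denom(M,x)²)^{-s}`.
[folklore] -/
theorem cpow_neg_sq_cfDenom (s : ℂ) (M : Matrix (Fin 2) (Fin 2) ℤ) {x : ℝ} (hd : 0 < cfDenom M x) :
    ((((cfDenom M x) ^ 2 : ℝ)) : ℂ) ^ (-s) = cfWt s M x := by
  have hd2 : (0 : ℝ) < cfDenom M x ^ 2 := pow_pos hd 2
  rw [cfWt, cpow_def_of_ne_zero (ofReal_ne_zero.2 hd2.ne'), ← ofReal_log hd2.le, Real.log_pow]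
  congr 1
  push_cast
  ring

/-! ### Summability, the count and the Dirichlet series of the family -/

section Family

/-- The fiber sums are the transfer-operator iterates:
`Σ_{w ∈ Aⁿ} a_w ℓ_w^{-s} = (L_sⁿ G)(x)` (as complex numbers). [cite: MageeOhWinter2019, §3.1 eq. (3.7)] -/
theorem sum_fiber_eq_cfLOp_pow (hA : ∀ a ∈ A, 1 ≤ a) {G : CfLip}
    (hGre : ∀ y : Icc (0 : ℝ) 1, (((G y).re : ℝ) : ℂ) = G y) (x : Icc (0 : ℝ) 1) (s : ℂ) (n : ℕ) :
    ∑ w : Fin n → A, ((cfWordWt A G x ⟨n, w⟩ : ℝ) : ℂ) * (((cfWordLen A x ⟨n, w⟩ : ℝ)) : ℂ) ^ (-s) =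
      (cfLOp A hA s ^ n) G x := by
  rw [cfLOp_pow_apply_eq_sum A hA]
  refine Finset.sum_congr rfl fun w _ => ?_
  rw [cfWordWt_coe hGre, cfWordLen, cpow_neg_sq_cfDenom s _ (cfDenom_cfMat_pos (one_le_coe_digit hA w) x.2),
    mul_comm]

/-- For real `σ`, `Σ_{w ∈ Aⁿ} a_w ℓ_w^{-σ} ≤ ‖L_σⁿ‖ ‖G‖`. [folklore] -/
theorem sum_fiber_le (hA : ∀ a ∈ A, 1 ≤ a) {G : CfLip} (hGre : ∀ y : Icc (0 : ℝ) 1, (((G y).re : ℝ) : ℂ) = G y)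
    (x : Icc (0 : ℝ) 1) (σ : ℝ) (n : ℕ) :
    ∑ w : Fin n → A, cfWordWt A G x ⟨n, w⟩ * cfWordLen A x ⟨n, w⟩ ^ (-σ) ≤ ‖cfLOp A hA (σ : ℂ) ^ n‖ * ‖G‖ := by
  have hre : ((∑ w : Fin n → A, cfWordWt A G x ⟨n, w⟩ * cfWordLen A x ⟨n, w⟩ ^ (-σ) : ℝ) : ℂ) =
      (cfLOp A hA (σ : ℂ) ^ n) G x := by
    rw [← sum_fiber_eq_cfLOp_pow hA hGre x (σ : ℂ) n]
    push_cast
    refine Finset.sum_congr rfl fun w _ => ?_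
    rw [ofReal_cpow (by linarith [one_le_cfWordLen hA x.2 ⟨n, w⟩]) (-σ)]
    push_cast
    ring_nf
  have h1 : ∑ w : Fin n → A, cfWordWt A G x ⟨n, w⟩ * cfWordLen A x ⟨n, w⟩ ^ (-σ) ≤
      ‖(cfLOp A hA (σ : ℂ) ^ n) G x‖ := by
    rw [← hre, Complex.norm_real, Real.norm_eq_abs]
    exact le_abs_self _
  refine h1.trans ((CfLip.norm_apply_le _ x).trans ?_)
  exact ContinuousLinearMap.le_opNorm _ _

/-- **Summability:** `Σ_w a_w ℓ_w^{-σ} < ∞` for `σ > δ_A` (from `Σ_n ‖L_σⁿ‖ < ∞`). [cite: MageeOhWinter2019, §3.1] -/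
theorem summable_cfWord (hA : ∀ a ∈ A, 1 ≤ a) (h2 : 2 ≤ A.card) {G : CfLip}
    (hGre : ∀ y : Icc (0 : ℝ) 1, (((G y).re : ℝ) : ℂ) = G y) (hG0 : ∀ y : Icc (0 : ℝ) 1, 0 ≤ (G y).re)
    (x : Icc (0 : ℝ) 1) {σ : ℝ} (hσ : cfDimension A < σ) :
    Summable fun w : cfWords A => cfWordWt A G x w * cfWordLen A x w ^ (-σ) := by
  have hnn : ∀ w : cfWords A, 0 ≤ cfWordWt A G x w * cfWordLen A x w ^ (-σ) := fun w =>
    mul_nonneg (cfWordWt_nonneg hG0 x w) (rpow_nonneg (by linarith [one_le_cfWordLen hA x.2 w]) _)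
  refine (summable_sigma_of_nonneg hnn).2 ⟨fun n => (hasSum_fintype _).summable, ?_⟩
  have hs : Summable fun n => ‖cfLOp A hA (σ : ℂ) ^ n‖ * ‖G‖ :=
    (summable_norm_cfLOp_pow A hA h2 (by simpa using hσ)).mul_right _
  refine Summable.of_nonneg_of_le (fun n => tsum_nonneg fun w => hnn ⟨n, w⟩) (fun n => ?_) hs
  rw [tsum_fintype]
  exact sum_fiber_le hA hGre x σ n

/-- **The weighted count of the family is the renewal count:** `Σ_w a_w 𝟙{ℓ_w ≤ X²} = N(X, x; G)` for `X ≥ 0`.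
[folklore] -/
theorem countFn_cfWord_eq (hA : ∀ a ∈ A, 1 ≤ a) (h2 : 2 ≤ A.card) {G : CfLip}
    (hGre : ∀ y : Icc (0 : ℝ) 1, (((G y).re : ℝ) : ℂ) = G y) (hG0 : ∀ y : Icc (0 : ℝ) 1, 0 ≤ (G y).re)
    (x : Icc (0 : ℝ) 1) {X : ℝ} (hX : 0 ≤ X) :
    PerronTwo.countFn (cfWordWt A G x) (cfWordLen A x) (X ^ 2) = cfFullCountW A G X x := by
  have hs := summable_cfWord hA h2 hGre hG0 x (σ := cfDimension A + 1) (by linarith)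
  have hsum := PerronTwo.summable_indicator (a := cfWordWt A G x) (ℓ := cfWordLen A x) (σ := cfDimension A + 1)
    (cfWordWt_nonneg hG0 x) (one_le_cfWordLen hA x.2) (by linarith [cfDimension_pos hA h2]) hs (X ^ 2)
  rw [PerronTwo.countFn, hsum.tsum_sigma' (fun n => (hasSum_fintype _).summable), cfFullCountW]
  refine tsum_congr fun n => ?_
  rw [tsum_fintype, cfLenCountW]
  refine Finset.sum_congr rfl fun w _ => ?_
  have hd := cfDenom_cfMat_pos (one_le_coe_digit hA w) x.2
  simp only [cfWordWt, cfWordLen]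
  by_cases hle : cfDenom (cfMat fun i => (w i : ℕ)) x ≤ X
  · rw [if_pos hle, if_pos ((pow_le_pow_iff_left₀ hd.le hX two_ne_zero).2 hle)]
  · rw [if_neg hle, if_neg fun h' => hle ((pow_le_pow_iff_left₀ hd.le hX two_ne_zero).1 h')]

/-- **The Dirichlet series of the family is the resolvent matrix coefficient:**
`Σ_w a_w ℓ_w^{-s} = Σ_n (L_sⁿ G)(x) = F_{G,x}(s)` for `Re s > δ_A`. [cite: MageeOhWinter2019, §3.1 eq. (3.6)–(3.7)] -/
theorem dirSeries_cfWord_eq (hA : ∀ a ∈ A, 1 ≤ a) (h2 : 2 ≤ A.card) {G : CfLip}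
    (hGre : ∀ y : Icc (0 : ℝ) 1, (((G y).re : ℝ) : ℂ) = G y) (hG0 : ∀ y : Icc (0 : ℝ) 1, 0 ≤ (G y).re)
    (x : Icc (0 : ℝ) 1) {s : ℂ} (hs : cfDimension A < s.re) :
    PerronTwo.dirSeries (cfWordWt A G x) (cfWordLen A x) s = cfResFun A hA G x s := by
  have hsumR := summable_cfWord hA h2 hGre hG0 x hs
  have hsumC : Summable fun w : cfWords A => ((cfWordWt A G x w : ℝ) : ℂ) * (((cfWordLen A x w : ℝ)) : ℂ) ^ (-s) := by
    refine Summable.of_norm (hsumR.congr fun w => ?_)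
    rw [norm_mul, Complex.norm_real, Real.norm_eq_abs, abs_of_nonneg (cfWordWt_nonneg hG0 x w),
      norm_cpow_eq_rpow_re_of_pos (by linarith [one_le_cfWordLen hA x.2 w])]
    simp
  rw [PerronTwo.dirSeries, hsumC.tsum_sigma' (fun n => (hasSum_fintype _).summable), cfResFun_eq_tsum A hA h2 G x hs]
  refine tsum_congr fun n => ?_
  rw [tsum_fintype, sum_fiber_eq_cfLOp_pow hA hGre x s n]

end Family

/-! ### The residue and the regular part of `F_{G,x}` -/

section Regular

variable (A) (hA : ∀ a ∈ A, 1 ≤ a) (h2 : 2 ≤ A.card)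

/-- The residue of `F_{G,x}` at `δ_A`: `r = ν(G) h(x)/κ_A` (`= δ_A c_G(x)`, `κ_A = ∫ 2h log(1/·) dν`).
[cite: MageeOhWinter2019, Lemma 16 (the constant `C(x,g)`)] -/
def cfRenewalRes (G : CfLip) (x : Icc (0 : ℝ) 1) : ℝ :=
  cfInt (cfNuδ A hA h2) (fun y => (G.extend y).re) * cfHδ A hA h2 x / cfInt (cfNuδ A hA h2) (cfG A hA h2)

/-- `r = δ_A c_G(x)`. [folklore] -/
theorem cfRenewalRes_eq (G : CfLip) (x : Icc (0 : ℝ) 1) :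
    cfRenewalRes A hA h2 G x = cfDimension A * cfRenewalConstW A hA h2 G x := by
  have hδ := (cfDimension_pos hA h2).ne'
  have hκ := (cfInt_cfG_pos A hA h2).ne'
  rw [cfRenewalRes, cfRenewalConstW]
  field_simp

/-- `r ≥ 0` for `G ≥ 0`. [folklore] -/
theorem cfRenewalRes_nonneg {G : CfLip} (hG0 : ∀ y : Icc (0 : ℝ) 1, 0 ≤ (G y).re) (x : Icc (0 : ℝ) 1) :
    0 ≤ cfRenewalRes A hA h2 G x := by
  refine div_nonneg (mul_nonneg ?_ (cfHδ_pos A hA h2 x.2).le) (cfInt_cfG_pos A hA h2).le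
  exact MeasureTheory.integral_nonneg fun y => hG0 _

/-- The singular part removed: `f_{G,x}(s) = F_{G,x}(s) − r/(s − δ_A)`. [cite: MageeOhWinter2019, §3.4] -/
def cfResSub (G : CfLip) (x : Icc (0 : ℝ) 1) (s : ℂ) : ℂ :=
  cfResFun A hA G x s - (cfRenewalRes A hA h2 G x : ℂ) / (s - cfDimension A)

/-- **The regular part `H_{G,x}`** of `F_{G,x}`: `f_{G,x}` with its removable singularity at `δ_A` filled in.
[cite: MageeOhWinter2019, §3.4] -/
def cfResReg (G : CfLip) (x : Icc (0 : ℝ) 1) : ℂ → ℂ :=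
  Function.update (cfResSub A hA h2 G x) (cfDimension A : ℂ)
    (limUnder (𝓝[≠] (cfDimension A : ℂ)) (cfResSub A hA h2 G x))

/-- Off `δ_A`, `H_{G,x} = F_{G,x} − r/(s − δ_A)`. [folklore] -/
theorem cfResReg_of_ne (G : CfLip) (x : Icc (0 : ℝ) 1) {s : ℂ} (hs : s ≠ (cfDimension A : ℂ)) :
    cfResReg A hA h2 G x s = cfResFun A hA G x s - (cfRenewalRes A hA h2 G x : ℂ) / (s - cfDimension A) := by
  rw [cfResReg, Function.update_of_ne hs, cfResSub]

/-- `F_{G,x}` is analytic at every `s ≠ δ_A` where `1 − L_s` is a unit. [folklore] -/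
theorem analyticAt_cfResFun (G : CfLip) (x : Icc (0 : ℝ) 1) {s : ℂ} (hs : IsUnit (1 - cfLOp A hA s)) :
    AnalyticAt ℂ (cfResFun A hA G x) s := by
  obtain ⟨u, hu⟩ := hs
  have h1 : AnalyticAt ℂ Ring.inverse (1 - cfLOp A hA s) := by
    rw [← hu]; exact analyticAt_inverse u
  have hW : AnalyticAt ℂ (fun s => 1 - cfLOp A hA s) s := analyticAt_const.sub (analyticAt_cfLOp A hA s)
  have h2' : AnalyticAt ℂ (fun s => Ring.inverse (1 - cfLOp A hA s)) s :=
    AnalyticAt.comp (g := Ring.inverse) (f := fun s => 1 - cfLOp A hA s) (x := s) h1 hW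
  have h := (((CfLip.eval x).comp (ContinuousLinearMap.apply ℂ CfLip G)).analyticAt _).comp h2'
  have heq : cfResFun A hA G x =
      (⇑((CfLip.eval x).comp (ContinuousLinearMap.apply ℂ CfLip G))) ∘ fun s => Ring.inverse (1 - cfLOp A hA s) := by
    funext s; rfl
  rw [heq]
  exact h

/-- `f_{G,x}` is analytic at every `s ≠ δ_A` where `1 − L_s` is a unit. [folklore] -/
theorem analyticAt_cfResSub (G : CfLip) (x : Icc (0 : ℝ) 1) {s : ℂ} (hs : IsUnit (1 - cfLOp A hA s))
    (hne : s ≠ (cfDimension A : ℂ)) : AnalyticAt ℂ (cfResSub A hA h2 G x) s := by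
  refine (analyticAt_cfResFun A hA G x hs).sub ?_
  exact analyticAt_const.div (analyticAt_id.sub analyticAt_const) (sub_ne_zero.2 hne)

/-- **Near `δ_A`, `f_{G,x}(s) = (W_reg(s) G)(x)`** on a punctured disc (`(1 − L_s)^{-1} = W_reg(s) + (s−δ_A)^{-1}κ_A^{-1}Π`
and `(Π G)(x) = ν(G) h(x)`), with `W_reg` analytic on the disc. [cite: MageeOhWinter2019, Lemma 16] -/
theorem cfResSub_eq_near_delta {G : CfLip} (hGre : ∀ y : Icc (0 : ℝ) 1, (((G y).re : ℝ) : ℂ) = G y)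
    (x : Icc (0 : ℝ) 1) :
    ∃ ε > 0, ∃ W : ℂ → ℂ, (∀ s ∈ ball (cfDimension A : ℂ) ε, AnalyticAt ℂ W s) ∧
      ∀ s ∈ ball (cfDimension A : ℂ) ε, s ≠ (cfDimension A : ℂ) → cfResSub A hA h2 G x s = W s := by
  obtain ⟨ε, hε, Wreg, han, hinv⟩ := cfResolvent_pole' A hA h2
  refine ⟨ε, hε, fun s => Wreg s G x, fun s hs => ?_, fun s hs hne => ?_⟩
  · have hΦ : AnalyticAt ℂ (fun T : CfLip →L[ℂ] CfLip => T G x) (Wreg s) :=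
      ((CfLip.eval x).comp (ContinuousLinearMap.apply ℂ CfLip G)).analyticAt _
    exact hΦ.comp (han s hs)
  · obtain ⟨hl, hr⟩ := hinv s hs hne
    have hκ : ((cfInt (cfNuδ A hA h2) (cfG A hA h2) : ℝ) : ℂ) ≠ 0 := ofReal_ne_zero.2 (cfInt_cfG_pos A hA h2).ne'
    have hsδ : (s - cfDimension A : ℂ) ≠ 0 := sub_ne_zero.2 hne
    rw [cfResSub, cfResFun, (Ring.inverse_unit ⟨_, _, hl, hr⟩ : Ring.inverse (1 - cfLOp A hA s) = _)]
    show (Wreg s + ((s - cfDimension A)⁻¹ * ((cfInt (cfNuδ A hA h2) (cfG A hA h2) : ℝ) : ℂ)⁻¹) • cfPi A hA h2)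
      G x - _ = _
    rw [show ∀ (P Q : CfLip →L[ℂ] CfLip) (F : CfLip), (P + Q) F = P F + Q F from fun _ _ _ => rfl,
      show ∀ (c : ℂ) (P : CfLip →L[ℂ] CfLip) (F : CfLip), (c • P) F = c • P F from fun _ _ _ => rfl,
      cfPi_apply, smul_smul, CfLip.add_apply, CfLip.smul_apply, cfHL_apply, cfNuL_eq_cfInt_re A hA h2 hGre,
      cfRenewalRes]
    push_cast
    field_simp
    ring

/-- **`H_{G,x}` is holomorphic on `Re s > σ₀`** as soon as `1 − L_s` is a unit there off `δ_A` (`σ₀ < δ_A`): analytic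
off `δ_A` as a resolvent coefficient, and across `δ_A` by the removable singularity theorem (it agrees with the
analytic `(W_reg(s) G)(x)` on a punctured disc). [cite: MageeOhWinter2019, §3.4 ("`n_q(s,x,φ')` is holomorphic for
`s` in this region")] -/
theorem differentiableOn_cfResReg {G : CfLip} (hGre : ∀ y : Icc (0 : ℝ) 1, (((G y).re : ℝ) : ℂ) = G y)
    (x : Icc (0 : ℝ) 1) {σ₀ : ℝ} (hσ₀δ : σ₀ < cfDimension A)
    (hunit : ∀ s : ℂ, σ₀ < s.re → s ≠ (cfDimension A : ℂ) → IsUnit (1 - cfLOp A hA s)) :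
    DifferentiableOn ℂ (cfResReg A hA h2 G x) {s : ℂ | σ₀ < s.re} := by
  obtain ⟨ε, hε, W, hWan, hWeq⟩ := cfResSub_eq_near_delta A hA h2 hGre x
  have hWc : ContinuousAt W (cfDimension A : ℂ) := (hWan _ (mem_ball_self hε)).continuousAt
  -- a small ball around `δ` inside the half-plane, inside the disc, on which `W` is bounded
  obtain ⟨ρ, hρ, hρsub⟩ : ∃ ρ > 0, ball (cfDimension A : ℂ) ρ ⊆
      ball (cfDimension A : ℂ) ε ∩ {s : ℂ | σ₀ < s.re} ∩ {s | ‖W s‖ < ‖W (cfDimension A : ℂ)‖ + 1} := by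
    have h3 : {s : ℂ | ‖W s‖ < ‖W (cfDimension A : ℂ)‖ + 1} ∈ 𝓝 (cfDimension A : ℂ) :=
      hWc.norm (Iio_mem_nhds (by linarith))
    refine Metric.mem_nhds_iff.1 (inter_mem (inter_mem (ball_mem_nhds _ hε) ?_) h3)
    exact (isOpen_lt continuous_const continuous_re).mem_nhds (by simpa using hσ₀δ)
  have hball : DifferentiableOn ℂ (cfResReg A hA h2 G x) (ball (cfDimension A : ℂ) ρ) := by
    refine differentiableOn_update_limUnder_of_bddAbove (ball_mem_nhds _ hρ) ?_ ?_
    · intro s hs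
      have hs' := hρsub hs.1
      have hne : s ≠ (cfDimension A : ℂ) := hs.2
      exact (analyticAt_cfResSub A hA h2 G x (hunit s hs'.1.2 hne) hne).differentiableAt.differentiableWithinAt
    · refine ⟨‖W (cfDimension A : ℂ)‖ + 1, ?_⟩
      rintro _ ⟨s, hs, rfl⟩
      have hs' := hρsub hs.1
      have hne : s ≠ (cfDimension A : ℂ) := hs.2
      simp only [Function.comp_apply]
      rw [hWeq s hs'.1.1 hne]
      exact le_of_lt hs'.2
  intro s hs
  by_cases hsδ : s = (cfDimension A : ℂ)
  · rw [hsδ]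
    exact (hball.differentiableAt (ball_mem_nhds _ hρ)).differentiableWithinAt
  · have hev : cfResReg A hA h2 G x =ᶠ[𝓝 s] cfResSub A hA h2 G x := by
      filter_upwards [isOpen_ne.mem_nhds hsδ] with z hz
      exact Function.update_of_ne hz _ _
    have hd : DifferentiableAt ℂ (cfResSub A hA h2 G x) s :=
      (analyticAt_cfResSub A hA h2 G x (hunit s hs hsδ) hsδ).differentiableAt
    exact (hd.congr_of_eventuallyEq hev).differentiableWithinAt

/-- **The bound at the pole point passes to the limit:** if `‖f_{G,x}(δ_A + it)‖ ≤ M(1+|t|)^κ` for `t ≠ 0`, then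
`‖H_{G,x}(δ_A)‖ ≤ M`. [folklore] -/
theorem norm_cfResReg_delta_le {G : CfLip} (hGre : ∀ y : Icc (0 : ℝ) 1, (((G y).re : ℝ) : ℂ) = G y)
    (x : Icc (0 : ℝ) 1) {σ₀ : ℝ} (hσ₀δ : σ₀ < cfDimension A)
    (hunit : ∀ s : ℂ, σ₀ < s.re → s ≠ (cfDimension A : ℂ) → IsUnit (1 - cfLOp A hA s)) {M κ : ℝ}
    (hb : ∀ t : ℝ, t ≠ 0 → ‖cfResSub A hA h2 G x ((cfDimension A : ℂ) + t * I)‖ ≤ M * (1 + |t|) ^ κ) :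
    ‖cfResReg A hA h2 G x (cfDimension A : ℂ)‖ ≤ M := by
  have hdiff := differentiableOn_cfResReg A hA h2 hGre x hσ₀δ hunit
  have hmem : {s : ℂ | σ₀ < s.re} ∈ 𝓝 (cfDimension A : ℂ) :=
    (isOpen_lt continuous_const continuous_re).mem_nhds (by simpa using hσ₀δ)
  have hcont : ContinuousAt (cfResReg A hA h2 G x) (cfDimension A : ℂ) := (hdiff.differentiableAt hmem).continuousAt
  -- along the vertical line through `δ`
  have hline : Tendsto (fun t : ℝ => (cfDimension A : ℂ) + t * I) (𝓝[≠] 0) (𝓝 (cfDimension A : ℂ)) := by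
    have h : Continuous fun t : ℝ => (cfDimension A : ℂ) + t * I := by fun_prop
    have h0 := h.tendsto 0
    simp only [ofReal_zero, zero_mul, add_zero] at h0
    exact h0.mono_left nhdsWithin_le_nhds
  have h1 : Tendsto (fun t : ℝ => ‖cfResReg A hA h2 G x ((cfDimension A : ℂ) + t * I)‖) (𝓝[≠] 0)
      (𝓝 ‖cfResReg A hA h2 G x (cfDimension A : ℂ)‖) := (hcont.tendsto.comp hline).norm
  have h2' : Tendsto (fun t : ℝ => M * (1 + |t|) ^ κ) (𝓝[≠] 0) (𝓝 M) := by
    have h : ContinuousAt (fun t : ℝ => M * (1 + |t|) ^ κ) 0 := by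
      refine continuousAt_const.mul (ContinuousAt.rpow_const (by fun_prop) (Or.inl (by norm_num)))
    have h0 := h.tendsto
    simp only [abs_zero, add_zero, Real.one_rpow, mul_one] at h0
    exact h0.mono_left nhdsWithin_le_nhds
  refine le_of_tendsto_of_tendsto h1 h2' ?_
  filter_upwards [self_mem_nhdsWithin] with t ht
  have hne : (cfDimension A : ℂ) + t * I ≠ (cfDimension A : ℂ) := by
    intro h
    apply ht
    have := congrArg Complex.im h
    simpa using this
  rw [cfResReg, Function.update_of_ne hne]
  exact hb t ht

/-! ### The theorem -/

/-- **Power saving for the renewal count of `Γ_A` from a finite-order resolvent bound.** Let `G ∈ CfLip` be real and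
non-negative on `[0,1]`, `x ∈ [0,1]`, `0 ≤ σ₀ < σ₁ < δ_A`, and assume
(units) `1 − L_s` is invertible for all `s` with `Re s > σ₀`, `s ≠ δ_A`;
(finite order) `‖F_{G,x}(u+it) − r/(u+it−δ_A)‖ ≤ M(1+|t|)^κ` for `σ₁ ≤ u ≤ δ_A+1` and `u + it ≠ δ_A`, where
`F_{G,x}(s) = ((1−L_s)^{-1}G)(x)` (`cfResFun`), `r = ν(G)h(x)/κ_A` (`cfRenewalRes`), `κ < 2`.
Then for every `X ≥ √2`,
`|N(X, x; G) − r X^{2δ_A}/δ_A| ≤ (r(2^{δ_A+1} + 1/δ_A) + M·(32/π)·2^{2+σ₁}·S(σ₁,κ)) · X^{2δ_A − 2(δ_A−σ₁)/3}`,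
`S = PerronTwo.shiftConst`: the error term of [MageeOhWinter2019, Prop. 17 / Thm. 11] for `q = 1` GIVEN the spectral
input of [MageeOhWinter2019, Thm. 4(2)] in resolvent form. [cite: MageeOhWinter2019, §3.4 Lemma 16 and Prop. 17] -/
theorem cfFullCountW_powerSaving_of_resolventBound {G : CfLip}
    (hGre : ∀ y : Icc (0 : ℝ) 1, (((G y).re : ℝ) : ℂ) = G y) (hG0 : ∀ y : Icc (0 : ℝ) 1, 0 ≤ (G y).re)
    (x : Icc (0 : ℝ) 1) {σ₀ σ₁ : ℝ} (hσ₀ : 0 ≤ σ₀) (hσ₀₁ : σ₀ < σ₁) (hσ₁ : σ₁ < cfDimension A)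
    (hunit : ∀ s : ℂ, σ₀ < s.re → s ≠ (cfDimension A : ℂ) → IsUnit (1 - cfLOp A hA s))
    {κ M : ℝ} (hκ : κ < 2) (hM : 0 ≤ M)
    (hbound : ∀ u : ℝ, σ₁ ≤ u → u ≤ cfDimension A + 1 → ∀ t : ℝ, (u : ℂ) + t * I ≠ (cfDimension A : ℂ) →
      ‖cfResFun A hA G x ((u : ℂ) + t * I) -
          (cfRenewalRes A hA h2 G x : ℂ) / (((u : ℂ) + t * I) - cfDimension A)‖ ≤ M * (1 + |t|) ^ κ)
    {X : ℝ} (hX : Real.sqrt 2 ≤ X) :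
    |cfFullCountW A G X x - cfRenewalRes A hA h2 G x * X ^ (2 * cfDimension A) / cfDimension A| ≤
      (cfRenewalRes A hA h2 G x * (2 ^ (cfDimension A + 1) + 1 / cfDimension A) +
          M * (32 / π * 2 ^ (2 + σ₁) * PerronTwo.shiftConst σ₁ κ)) *
        X ^ (2 * cfDimension A - 2 * ((cfDimension A - σ₁) / 3)) := by
  have hδ := cfDimension_pos hA h2
  have hσ₀δ : σ₀ < cfDimension A := hσ₀₁.trans hσ₁
  have hR0 : 0 ≤ X := (Real.sqrt_nonneg 2).trans hX
  have hx2 : 2 ≤ X ^ 2 := by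
    have h := pow_le_pow_left₀ (Real.sqrt_nonneg 2) hX 2
    rwa [Real.sq_sqrt (by norm_num)] at h
  -- the data of the effective Perron theorem
  have hH := differentiableOn_cfResReg A hA h2 hGre x hσ₀δ hunit
  have hD : ∀ s : ℂ, cfDimension A < s.re →
      PerronTwo.dirSeries (cfWordWt A G x) (cfWordLen A x) s =
        (cfRenewalRes A hA h2 G x : ℂ) / (s - cfDimension A) + cfResReg A hA h2 G x s := by
    intro s hs
    have hne : s ≠ (cfDimension A : ℂ) := by
      intro h; rw [h] at hs; simp at hs
    rw [dirSeries_cfWord_eq hA h2 hGre hG0 x hs, cfResReg_of_ne A hA h2 G x hne]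
    ring
  have hHb : ∀ u : ℝ, σ₁ ≤ u → u ≤ cfDimension A + 1 → ∀ t : ℝ,
      ‖cfResReg A hA h2 G x ((u : ℂ) + t * I)‖ ≤ M * (1 + |t|) ^ κ := by
    intro u hu1 hu2 t
    by_cases hst : (u : ℂ) + t * I = (cfDimension A : ℂ)
    · have hu : u = cfDimension A := by have := congrArg Complex.re hst; simpa using this
      have ht : t = 0 := by have := congrArg Complex.im hst; simpa using this
      rw [hst, ht, abs_zero, add_zero, Real.one_rpow, mul_one]
      refine norm_cfResReg_delta_le A hA h2 hGre x hσ₀δ hunit (κ := κ) fun t' ht' => ?_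
      have hne : (cfDimension A : ℂ) + t' * I ≠ (cfDimension A : ℂ) := by
        intro h; apply ht'; have := congrArg Complex.im h; simpa using this
      have h := hbound (cfDimension A) hσ₁.le (by linarith) t' hne
      rwa [cfResSub]
    · rw [cfResReg_of_ne A hA h2 G x hst]
      exact hbound u hu1 hu2 t hst
  have hmain := PerronTwo.abs_countFn_sub_main_le (a := cfWordWt A G x) (ℓ := cfWordLen A x)
    (cfWordWt_nonneg hG0 x) (one_le_cfWordLen hA x.2) hδ (fun σ hσ => summable_cfWord hA h2 hGre hG0 x hσ)
    (cfRenewalRes_nonneg A hA h2 hG0 x) hσ₀ hσ₀₁ hσ₁ hH hD hκ hM hHb hx2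
  rw [countFn_cfWord_eq hA h2 hGre hG0 x hR0] at hmain
  have hpow : ∀ e : ℝ, (X ^ 2) ^ e = X ^ (2 * e) := fun e => by
    rw [show X ^ 2 = X ^ ((2 : ℕ) : ℝ) from (rpow_natCast X 2).symm, ← rpow_mul hR0]; norm_num
  rw [hpow, hpow] at hmain
  have hexp : 2 * (cfDimension A - (cfDimension A - σ₁) / 3) = 2 * cfDimension A - 2 * ((cfDimension A - σ₁) / 3) := by
    ring
  rw [hexp] at hmain
  exact hmain

/-- The same with the main term written through the renewal constant `c_G(x)` of `cfFullCountW_asymp`: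
`|N(X, x; G) − c_G(x) X^{2δ_A}| ≤ C X^{2δ_A − 2(δ_A−σ₁)/3}`. [cite: MageeOhWinter2019, Prop. 17] -/
theorem cfFullCountW_powerSaving_of_resolventBound' {G : CfLip}
    (hGre : ∀ y : Icc (0 : ℝ) 1, (((G y).re : ℝ) : ℂ) = G y) (hG0 : ∀ y : Icc (0 : ℝ) 1, 0 ≤ (G y).re)
    (x : Icc (0 : ℝ) 1) {σ₀ σ₁ : ℝ} (hσ₀ : 0 ≤ σ₀) (hσ₀₁ : σ₀ < σ₁) (hσ₁ : σ₁ < cfDimension A)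
    (hunit : ∀ s : ℂ, σ₀ < s.re → s ≠ (cfDimension A : ℂ) → IsUnit (1 - cfLOp A hA s))
    {κ M : ℝ} (hκ : κ < 2) (hM : 0 ≤ M)
    (hbound : ∀ u : ℝ, σ₁ ≤ u → u ≤ cfDimension A + 1 → ∀ t : ℝ, (u : ℂ) + t * I ≠ (cfDimension A : ℂ) →
      ‖cfResFun A hA G x ((u : ℂ) + t * I) -
          (cfRenewalRes A hA h2 G x : ℂ) / (((u : ℂ) + t * I) - cfDimension A)‖ ≤ M * (1 + |t|) ^ κ)
    {X : ℝ} (hX : Real.sqrt 2 ≤ X) :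
    |cfFullCountW A G X x - cfRenewalConstW A hA h2 G x * X ^ (2 * cfDimension A)| ≤
      (cfRenewalRes A hA h2 G x * (2 ^ (cfDimension A + 1) + 1 / cfDimension A) +
          M * (32 / π * 2 ^ (2 + σ₁) * PerronTwo.shiftConst σ₁ κ)) *
        X ^ (2 * cfDimension A - 2 * ((cfDimension A - σ₁) / 3)) := by
  have h := cfFullCountW_powerSaving_of_resolventBound A hA h2 hGre hG0 x hσ₀ hσ₀₁ hσ₁ hunit hκ hM hbound hX
  have hδ := (cfDimension_pos hA h2).ne'
  have heq : cfRenewalRes A hA h2 G x * X ^ (2 * cfDimension A) / cfDimension A =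
      cfRenewalConstW A hA h2 G x * X ^ (2 * cfDimension A) := by
    rw [cfRenewalRes_eq]; field_simp
  rwa [heq] at h

end Regular

end Literature.NumberTheory.Sieve
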